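import Summits.Parity.GeneralizedHardyLittlewood.Theorems.LeeYangFibresFibrationLemmaDefs
import Summits.Parity.GeneralizedHardyLittlewood.Theorems.LeeYangFibresFibrationLemmaLocal
import HarnessLib

/-!
# Fibration lemma (`DimOne → GeneralizedHardyLittlewood`), part 3: discriminant forms and bad fibres

Support file for the statement item `FibrationLemma : DimOne → GeneralizedHardyLittlewood`
(Green–Tao 2010, §1, remark after Conj. 1.2). For a system `Ψ` on `ℤ^{d+1}` fibred over its first
`d` coordinates (part 1), the pair discriminants of the fibre system `Φ_w` are the values at `w` of
affine-linear forms on `ℤ^d`, the *discriminant forms*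

  `Dᵢⱼ(w) = aᵢ ψⱼᵇ(w) - aⱼ ψᵢᵇ(w)`                                   (`discForm`, `disc_fibreSystem`).

* `isNondegenerateSystem_fibreSystem` — if all `aᵢ ≠ 0` and `Dᵢⱼ(w) ≠ 0` for `i ≠ j` then `Φ_w`
  satisfies the standing hypotheses (is a legitimate input of `DimOne`);
* `discForm_ne_zero` — for a non-degenerate `Ψ` with `aᵢ ≠ 0`, no `Dᵢⱼ` (`i ≠ j`) is the zero form;
* `card_badSet_le` — hence the *bad* base points `w ∈ [-N,N]^d` (some `Dᵢⱼ(w) = 0`, `i ≠ j`) number at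
  most `t² (2N+1)^{d-1}` (a non-zero affine form vanishes on at most `(2N+1)^{d-1}` points of the box,
  `card_filter_eval_eq_le`);
* `card_filter_dvd_eval_le` — a form with a non-zero coefficient is divisible by `p` on at most
  `(2M/p + 1)·(2N+1)^{d-1}`-ish points of the box, `M` a bound for its values (used with the
  non-parallel discriminant forms);
* `abs_discForm_eval_le` — `|Dᵢⱼ(w)| ≤ 2 L² (d + 1) N` on the box.
-/

noncomputable section

open Finset

namespace Summit.Parity.GeneralizedHardyLittlewood.Theorems

open Literature.NumberTheory.Sieve

variable {d t : ℕ}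

/-! ### Discriminant forms -/

/-- The discriminant form `Dᵢⱼ = aᵢ ψⱼᵇ - aⱼ ψᵢᵇ` on `ℤ^d` of the pair `(i, j)` of a system on
`ℤ^{d+1}` (`aᵢ = lastCoeff ψᵢ`, `ψᵢᵇ = baseForm ψᵢ`). [cite: GreenTao2010, §1 (remark after Conj. 1.2)] -/
def discForm (Ψ : Fin t → AffLinForm (d + 1)) (i j : Fin t) : AffLinForm d :=
  ⟨fun k => lastCoeff (Ψ i) * (Ψ j).coeff (Fin.castSucc k) - lastCoeff (Ψ j) * (Ψ i).coeff (Fin.castSucc k),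
    lastCoeff (Ψ i) * (Ψ j).const - lastCoeff (Ψ j) * (Ψ i).const⟩

/-- `Dᵢⱼ(w) = aᵢ ψⱼᵇ(w) - aⱼ ψᵢᵇ(w)`. [folklore] -/
theorem discForm_eval (Ψ : Fin t → AffLinForm (d + 1)) (i j : Fin t) (w : Fin d → ℤ) :
    (discForm Ψ i j).eval w =
      lastCoeff (Ψ i) * (baseForm (Ψ j)).eval w - lastCoeff (Ψ j) * (baseForm (Ψ i)).eval w := by
  simp only [AffLinForm.eval, discForm, baseForm]
  have h : ∀ x : Fin d,
      (lastCoeff (Ψ i) * (Ψ j).coeff x.castSucc - lastCoeff (Ψ j) * (Ψ i).coeff x.castSucc) * w x =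
        lastCoeff (Ψ i) * ((Ψ j).coeff x.castSucc * w x) -
          lastCoeff (Ψ j) * ((Ψ i).coeff x.castSucc * w x) := fun x => by ring
  simp only [h, Finset.sum_sub_distrib, ← Finset.mul_sum]
  ring

/-- **The pair discriminants of the fibre system are the discriminant forms evaluated at the base
point**: `disc Φ_w i j = Dᵢⱼ(w)`. [cite: GreenTao2010, §1 (remark after Conj. 1.2)] -/
theorem disc_fibreSystem (Ψ : Fin t → AffLinForm (d + 1)) (w : Fin d → ℤ) (i j : Fin t) :
    disc (fibreSystem Ψ w) i j = (discForm Ψ i j).eval w := by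
  rw [discForm_eval, disc]
  simp [fibreSystem]

/-- `Dᵢⱼ(w, ·)` detects proportionality: `aᵢ ψⱼ(w, m) - aⱼ ψᵢ(w, m) = Dᵢⱼ(w)` for every `m`.
[folklore] -/
theorem discForm_eval_eq_comb (Ψ : Fin t → AffLinForm (d + 1)) (i j : Fin t) (w : Fin d → ℤ) (m : ℤ) :
    (discForm Ψ i j).eval w =
      lastCoeff (Ψ i) * (Ψ j).eval (Fin.snoc w m) - lastCoeff (Ψ j) * (Ψ i).eval (Fin.snoc w m) := by
  rw [discForm_eval, eval_snoc, eval_snoc]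
  ring

/-! ### Non-degeneracy of the fibre systems -/

/-- If `aᵢ ≠ 0` for all `i` and `Dᵢⱼ(w) ≠ 0` for all `i ≠ j`, the fibre system `Φ_w` satisfies
Green–Tao's standing hypotheses (every form non-constant, no two forms rational multiples of each
other). [cite: GreenTao2010, Def. 1.1] -/
theorem isNondegenerateSystem_fibreSystem (Ψ : Fin t → AffLinForm (d + 1))
    (ha : ∀ i, lastCoeff (Ψ i) ≠ 0) {w : Fin d → ℤ}
    (hD : ∀ i j, i ≠ j → (discForm Ψ i j).eval w ≠ 0) : IsNondegenerateSystem (fibreSystem Ψ w) := by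
  refine ⟨fun i h => ha i ?_, fun i j hij a b hab => ?_⟩
  · have := congr_fun h 0
    simpa [fibreSystem] using this
  · -- evaluate `a φᵢ = b φⱼ` at `0` and `1`
    have h0 := hab (fun _ => 0)
    have h1 := hab (fun _ => 1)
    simp only [fibreSystem, fibreForm_eval, mul_zero, zero_add, mul_one] at h0 h1
    have h1' : a * lastCoeff (Ψ i) = b * lastCoeff (Ψ j) := by linarith
    have hDij := hD i j hij
    rw [discForm_eval] at hDij
    by_contra hne
    have hab0 : a ≠ 0 ∨ b ≠ 0 := by tauto
    -- `a Dᵢⱼ(w) = 0` and `b Dᵢⱼ(w) = 0`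
    have e1 : a * (lastCoeff (Ψ i) * (baseForm (Ψ j)).eval w - lastCoeff (Ψ j) * (baseForm (Ψ i)).eval w) = 0 := by
      linear_combination ((baseForm (Ψ j)).eval w) * h1' - (lastCoeff (Ψ j)) * h0
    have e2 : b * (lastCoeff (Ψ i) * (baseForm (Ψ j)).eval w - lastCoeff (Ψ j) * (baseForm (Ψ i)).eval w) = 0 := by
      linear_combination ((baseForm (Ψ i)).eval w) * h1' - (lastCoeff (Ψ i)) * h0
    rcases hab0 with h | h
    · exact hDij ((mul_eq_zero.mp e1).resolve_left h)
    · exact hDij ((mul_eq_zero.mp e2).resolve_left h)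

/-- For a non-degenerate `Ψ` (with `aᵢ ≠ 0`) and `i ≠ j`, the discriminant form `Dᵢⱼ` is not the
zero form: otherwise `aᵢ ψⱼ = aⱼ ψᵢ` identically. [cite: GreenTao2010, Def. 1.1] -/
theorem discForm_ne_zero {Ψ : Fin t → AffLinForm (d + 1)} (hΨ : IsNondegenerateSystem Ψ)
    (ha : ∀ i, lastCoeff (Ψ i) ≠ 0) {i j : Fin t} (hij : i ≠ j) :
    (discForm Ψ i j).coeff ≠ 0 ∨ (discForm Ψ i j).const ≠ 0 := by
  by_contra h
  push Not at h
  obtain ⟨hc, h0⟩ := h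
  have hzero : ∀ w, (discForm Ψ i j).eval w = 0 := fun w => by
    simp only [AffLinForm.eval, hc, h0, Pi.zero_apply, zero_mul, Finset.sum_const_zero, add_zero]
  -- `aⱼ ψᵢ = aᵢ ψⱼ` on all of `ℤ^{d+1}`
  have hprop : ∀ n : Fin (d + 1) → ℤ, lastCoeff (Ψ j) * (Ψ i).eval n = lastCoeff (Ψ i) * (Ψ j).eval n := by
    intro n
    have := discForm_eval_eq_comb Ψ i j (Fin.init n) (n (Fin.last d))
    rw [Fin.snoc_init_self, hzero] at this
    linarith
  exact ha i (hΨ.2 i j hij _ _ hprop).2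

/-! ### Counting bad base points -/

/-- A form which is not the zero form vanishes on at most `(2N+1)^{d-1}` points of `[-N,N]^d`.
[folklore] -/
theorem card_filter_eval_eq_zero_le (φ : AffLinForm d) (hφ : φ.coeff ≠ 0 ∨ φ.const ≠ 0) (N : ℕ) :
    #{w ∈ latticeBox d N | φ.eval w = 0} ≤ (2 * N + 1) ^ (d - 1) := by
  classical
  rcases hφ with hc | h0
  · obtain ⟨k, hk⟩ : ∃ k, φ.coeff k ≠ 0 := by
      by_contra h
      push Not at h
      exact hc (funext h)
    exact card_filter_eval_eq_le φ hk N 0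
  · by_cases hc : φ.coeff = 0
    · have : ({w ∈ latticeBox d N | φ.eval w = 0} : Finset _) = ∅ := by
        refine Finset.filter_eq_empty_iff.mpr fun w _ => ?_
        simp only [AffLinForm.eval, hc, Pi.zero_apply, zero_mul, Finset.sum_const_zero, zero_add]
        exact h0
      rw [this, Finset.card_empty]
      exact Nat.zero_le _
    · obtain ⟨k, hk⟩ : ∃ k, φ.coeff k ≠ 0 := by
        by_contra h
        push Not at h
        exact hc (funext h)
      exact card_filter_eval_eq_le φ hk N 0

open Classical in
/-- The *bad* base points: `w ∈ [-N,N]^d` with `Dᵢⱼ(w) = 0` for some `i ≠ j` (the fibre system over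
`w` is degenerate). [cite: GreenTao2010, §1 (remark after Conj. 1.2)] -/
def badSet (Ψ : Fin t → AffLinForm (d + 1)) (N : ℕ) : Finset (Fin d → ℤ) :=
  {w ∈ latticeBox d N | ∃ i j, i ≠ j ∧ (discForm Ψ i j).eval w = 0}

open Classical in
/-- The *good* base points: the complement of `badSet` in the box. [folklore] -/
def goodSet (Ψ : Fin t → AffLinForm (d + 1)) (N : ℕ) : Finset (Fin d → ℤ) :=
  {w ∈ latticeBox d N | ∀ i j, i ≠ j → (discForm Ψ i j).eval w ≠ 0}

/-- `badSet ⊆ box`. [folklore] -/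
theorem badSet_subset (Ψ : Fin t → AffLinForm (d + 1)) (N : ℕ) : badSet Ψ N ⊆ latticeBox d N := by
  classical
  unfold badSet; exact Finset.filter_subset _ _

/-- `goodSet ⊆ box`. [folklore] -/
theorem goodSet_subset (Ψ : Fin t → AffLinForm (d + 1)) (N : ℕ) : goodSet Ψ N ⊆ latticeBox d N := by
  classical
  unfold goodSet; exact Finset.filter_subset _ _

/-- Membership in `goodSet`. [folklore] -/
theorem mem_goodSet {Ψ : Fin t → AffLinForm (d + 1)} {N : ℕ} {w : Fin d → ℤ} :
    w ∈ goodSet Ψ N ↔ w ∈ latticeBox d N ∧ ∀ i j, i ≠ j → (discForm Ψ i j).eval w ≠ 0 := by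
  classical
  unfold goodSet; rw [Finset.mem_filter]

/-- The box is the disjoint union of the good and the bad base points: sums split accordingly.
[folklore] -/
theorem sum_latticeBox_eq_sum_goodSet_add_sum_badSet {M : Type*} [AddCommMonoid M]
    (Ψ : Fin t → AffLinForm (d + 1)) (N : ℕ) (F : (Fin d → ℤ) → M) :
    ∑ w ∈ latticeBox d N, F w = ∑ w ∈ goodSet Ψ N, F w + ∑ w ∈ badSet Ψ N, F w := by
  classical
  unfold goodSet badSet
  rw [← Finset.sum_filter_add_sum_filter_not (latticeBox d N)
    (fun w => ∀ i j, i ≠ j → (discForm Ψ i j).eval w ≠ 0)]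
  congr 1
  refine Finset.sum_congr (Finset.filter_congr fun w _ => ?_) fun _ _ => rfl
  push Not
  rfl

/-- `#goodSet ≤ (2N+1)^d`. [folklore] -/
theorem card_goodSet_le (Ψ : Fin t → AffLinForm (d + 1)) (N : ℕ) : #(goodSet Ψ N) ≤ (2 * N + 1) ^ d := by
  refine (Finset.card_le_card (goodSet_subset Ψ N)).trans (le_of_eq ?_)
  have h1 : ((N : ℤ) + 1 - -(N : ℤ)) = ((2 * N + 1 : ℕ) : ℤ) := by push_cast; ring
  simp only [latticeBox, Fintype.card_piFinset, Int.card_Icc, Finset.prod_const, Finset.card_univ,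
    Fintype.card_fin, h1, Int.toNat_natCast]

/-- **Few bad fibres**: for a non-degenerate `Ψ` with all `aᵢ ≠ 0`,
`#badSet ≤ t² (2N+1)^{d-1}`. [cite: GreenTao2010, §1 (remark after Conj. 1.2)] -/
theorem card_badSet_le {Ψ : Fin t → AffLinForm (d + 1)} (hΨ : IsNondegenerateSystem Ψ)
    (ha : ∀ i, lastCoeff (Ψ i) ≠ 0) (N : ℕ) : #(badSet Ψ N) ≤ t * t * (2 * N + 1) ^ (d - 1) := by
  classical
  have hsub : badSet Ψ N ⊆ ((univ : Finset (Fin t)).offDiag).biUnion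
      fun ij => {w ∈ latticeBox d N | (discForm Ψ ij.1 ij.2).eval w = 0} := by
    intro w hw
    unfold badSet at hw
    obtain ⟨hbox, i, j, hij, h0⟩ := Finset.mem_filter.mp hw
    exact Finset.mem_biUnion.mpr ⟨(i, j), Finset.mem_offDiag.mpr ⟨Finset.mem_univ _, Finset.mem_univ _, hij⟩,
      Finset.mem_filter.mpr ⟨hbox, h0⟩⟩
  calc #(badSet Ψ N) ≤ _ := Finset.card_le_card hsub
    _ ≤ ∑ ij ∈ (univ : Finset (Fin t)).offDiag, #{w ∈ latticeBox d N | (discForm Ψ ij.1 ij.2).eval w = 0} :=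
        Finset.card_biUnion_le
    _ ≤ ∑ _ij ∈ (univ : Finset (Fin t)).offDiag, (2 * N + 1) ^ (d - 1) :=
        Finset.sum_le_sum fun ij hij =>
          card_filter_eval_eq_zero_le _ (discForm_ne_zero hΨ ha (Finset.mem_offDiag.mp hij).2.2) N
    _ ≤ t * t * (2 * N + 1) ^ (d - 1) := by
        rw [Finset.sum_const, smul_eq_mul, Finset.offDiag_card, Finset.card_univ, Fintype.card_fin]
        exact Nat.mul_le_mul_right _ (Nat.sub_le _ _)

/-- On a good base point the fibre system is non-degenerate. [cite: GreenTao2010, Def. 1.1] -/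
theorem isNondegenerateSystem_of_mem_goodSet {Ψ : Fin t → AffLinForm (d + 1)}
    (ha : ∀ i, lastCoeff (Ψ i) ≠ 0) {N : ℕ} {w : Fin d → ℤ} (hw : w ∈ goodSet Ψ N) :
    IsNondegenerateSystem (fibreSystem Ψ w) :=
  isNondegenerateSystem_fibreSystem Ψ ha (mem_goodSet.mp hw).2

/-! ### Divisibility of the values of a form on the box -/

/-- A form with a non-zero coefficient, bounded by `M` in absolute value on the box, is divisible by
`p ≥ 1` on at most `(2 (M/p) + 1) (2N+1)^{d-1}` points of the box (each multiple of `p` in `[-M, M]`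
is taken at most `(2N+1)^{d-1}` times). [folklore] -/
theorem card_filter_dvd_eval_le (φ : AffLinForm d) {k : Fin d} (hk : φ.coeff k ≠ 0) (N : ℕ) {p : ℕ}
    (hp : 1 ≤ p) {M : ℕ} (hM : ∀ w ∈ latticeBox d N, |φ.eval w| ≤ M) :
    #{w ∈ latticeBox d N | (p : ℤ) ∣ φ.eval w} ≤ (2 * (M / p) + 1) * (2 * N + 1) ^ (d - 1) := by
  classical
  set R : ℕ := M / p
  have hsub : ({w ∈ latticeBox d N | (p : ℤ) ∣ φ.eval w} : Finset _) ⊆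
      (Finset.Icc (-(R : ℤ)) R).biUnion fun r => {w ∈ latticeBox d N | φ.eval w = r * p} := by
    intro w hw
    obtain ⟨hbox, r, hr⟩ := Finset.mem_filter.mp hw
    have hrR : |r| ≤ R := by
      have h1 : |φ.eval w| ≤ M := hM w hbox
      rw [hr, abs_mul, Nat.abs_cast] at h1
      have hp0 : (0 : ℤ) < p := by exact_mod_cast hp
      have h2 : |r| ≤ (M : ℤ) / p := by
        rw [Int.le_ediv_iff_mul_le hp0]; linarith [mul_comm (|r|) (p : ℤ)]
      calc |r| ≤ (M : ℤ) / p := h2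
        _ = ((M / p : ℕ) : ℤ) := by simp
    refine Finset.mem_biUnion.mpr ⟨r, Finset.mem_Icc.mpr (abs_le.mp hrR), Finset.mem_filter.mpr ⟨hbox, ?_⟩⟩
    rw [hr, mul_comm]
  calc #({w ∈ latticeBox d N | (p : ℤ) ∣ φ.eval w} : Finset _) ≤ _ := Finset.card_le_card hsub
    _ ≤ ∑ r ∈ Finset.Icc (-(R : ℤ)) R, #{w ∈ latticeBox d N | φ.eval w = r * p} := Finset.card_biUnion_le
    _ ≤ ∑ _r ∈ Finset.Icc (-(R : ℤ)) R, (2 * N + 1) ^ (d - 1) :=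
        Finset.sum_le_sum fun r _ => card_filter_eval_eq_le φ hk N _
    _ = (2 * (M / p) + 1) * (2 * N + 1) ^ (d - 1) := by
        rw [Finset.sum_const, smul_eq_mul, Int.card_Icc]
        congr 1
        omega

/-! ### Size of the discriminants on the box -/

/-- `|Dᵢⱼ(w)| ≤ 2 L² (d + 1) N` for `w ∈ [-N,N]^d` when `|ψ̇ᵢ(e_j)| ≤ L` and `|ψᵢ(0)| ≤ L N`.
[folklore] -/
theorem abs_discForm_eval_le {Ψ : Fin t → AffLinForm (d + 1)} {L N : ℕ}
    (hL : ∀ i j, ((Ψ i).coeff j).natAbs ≤ L) (hc : ∀ i, (Ψ i).const.natAbs ≤ L * N)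
    {w : Fin d → ℤ} (hw : w ∈ latticeBox d N) (i j : Fin t) :
    |(discForm Ψ i j).eval w| ≤ (2 * L * L * (d + 1) * N : ℕ) := by
  have hai : |lastCoeff (Ψ i)| ≤ L := by
    rw [Int.abs_eq_natAbs]; exact_mod_cast hL i (Fin.last d)
  have haj : |lastCoeff (Ψ j)| ≤ L := by
    rw [Int.abs_eq_natAbs]; exact_mod_cast hL j (Fin.last d)
  have hbi := abs_baseForm_eval_le (hL i) (hc i) hw
  have hbj := abs_baseForm_eval_le (hL j) (hc j) hw
  rw [discForm_eval]
  calc |lastCoeff (Ψ i) * (baseForm (Ψ j)).eval w - lastCoeff (Ψ j) * (baseForm (Ψ i)).eval w|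
      ≤ |lastCoeff (Ψ i) * (baseForm (Ψ j)).eval w| + |lastCoeff (Ψ j) * (baseForm (Ψ i)).eval w| :=
        abs_sub _ _
    _ ≤ (L : ℤ) * (d * L * N + L * N : ℕ) + (L : ℤ) * (d * L * N + L * N : ℕ) := by
        rw [abs_mul, abs_mul]
        exact add_le_add (mul_le_mul hai hbj (abs_nonneg _) (by positivity))
          (mul_le_mul haj hbi (abs_nonneg _) (by positivity))
    _ = (2 * L * L * (d + 1) * N : ℕ) := by push_cast; ring

end Summit.Parity.GeneralizedHardyLittlewood.Theorems
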